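import Mathlib.Analysis.Convex.Jensen
import Summits.Ventures.CertifiedArithmetic.LowPrec.SRDoubleRoundingOrder
import Summits.Ventures.CertifiedArithmetic.LowPrec.SRLimitedBits
import HarnessLib

/-!
# Stochastic rounding is the optimal unbiased rounding; the exact bias–MSE frontier (file LV)

HONEST FRAMING: certified error envelopes and provably optimal rounding/accumulation schemes for
low-precision formats under stated cost models; every table by two implementations; no hardware or
vendor claims.

A *randomised rounding into `F`* of a value `a` is any probability vector `w` on the finite
value set `F` (`w ≥ 0`, `∑ w = 1`); its mean is `m = ∑ w(y)·y`, which lies in the representable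
hull.  CHM stochastic rounding `SR_F(m)` is the particular one supported on the two candidates
`⌊m⌋, ⌈m⌉`.  This file proves, exactly over any linearly ordered field:

* `step_le_law` — **SR is the convex-order minimum.**  For every convex test function `f` and
  every randomised rounding `w` with mean `m`:  `E f(SR_F(m)) ≤ ∑ w(y) f(y)`.  In particular
  (`srVar_le_law_of_mean_eq`) SR has the least variance — indeed the least `p`-th absolute
  moment, exponential moment, … — among ALL unbiased `F`-valued roundings of `a`; there is
  nothing to gain from spreading mass beyond the two neighbours.
* `law_sq_eq_frontier_add` — **the exact bias–MSE frontier.**  For `a` in the hull with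
  neighbours `d ≤ a ≤ u` and ANY rounding `w` with mean `m`:
  `∑ w(y)(y − a)² = v_F(a) + (m − a)(d + u − 2a) + ∑ w(y)(y − d)(y − u)`,
  where `v_F(a) = (a − d)(u − a)` is the SR variance and the last sum (the *off-cell penalty*)
  is `≥ 0`, vanishing iff `w` lives on `{d, u}` (`law_sq_eq_frontier_iff`).  Hence the
  achievable (bias, MSE) pairs lie on or above the LINE `MSE = v_F(a) + bias·(d + u − 2a)`;
  the two-point laws are exactly the frontier; SR is its `bias = 0` point, round-to-nearest its
  lower end (`law_sq_ge_nearest`), and (`law_eq_sr_of_var_eq`) SR is the UNIQUE unbiased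
  rounding attaining `v_F(a)`.
* `stepQ_sq_eq_frontier` — every limited-random-bits rounding `SR_{q}` (file XIX: any
  probability assignment on the two candidates — floor/`StochasticA`, round-to-nearest
  probability/`StochasticC`, …) lies ON the frontier: its MSE is `v_F(c) + bias·(d + u − 2c)`
  exactly, so its MSE is below the SR variance iff its bias points towards the nearer
  neighbour (`stepQ_sq_le_srVar_iff`).

Nearest prior art (searched, see the unit's FRESHNESS file): the coarsening lemma of
Zhang et al. (ZipML, arXiv:1611.05402, Lemma 12: unbiased quantisation variance is monotone
under grid coarsening, proof omitted) and the s-convex extremal laws of Denuit–Lefèvre–Utev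
(Shaked–Shanthikumar, *Stochastic Orders*, §3.A) are the classical shapes; the statements here
are for an arbitrary finite value set with saturation built into the hull hypothesis, and are
kernel-checked.
-/

namespace Summit.Ventures.CertifiedArithmetic.LowPrec.SR

open Literature.ComputerArithmetic.ConnollyHighamMary2021
open Finset

section Generic

variable {K : Type*} [Field K] [LinearOrder K] [IsStrictOrderedRing K]

/-! ### Randomised roundings into `F` -/

/-- The mean of a probability vector on a nonempty `F` lies in the representable hull. -/
theorem law_inHull {F : Finset K} (hF : F.Nonempty) {w : K → K} (hw : ∀ y ∈ F, 0 ≤ w y)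
    (h1 : ∑ y ∈ F, w y = 1) : InHull F (∑ y ∈ F, w y * y) := by
  refine ⟨⟨F.min' hF, F.min'_mem hF, ?_⟩, ⟨F.max' hF, F.max'_mem hF, ?_⟩⟩
  · calc F.min' hF = ∑ y ∈ F, w y * F.min' hF := by rw [← Finset.sum_mul, h1, one_mul]
      _ ≤ ∑ y ∈ F, w y * y :=
        Finset.sum_le_sum fun y hy => mul_le_mul_of_nonneg_left (F.min'_le y hy) (hw y hy)
  · calc ∑ y ∈ F, w y * y ≤ ∑ y ∈ F, w y * F.max' hF :=
        Finset.sum_le_sum fun y hy => mul_le_mul_of_nonneg_left (F.le_max' y hy) (hw y hy)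
      _ = F.max' hF := by rw [← Finset.sum_mul, h1, one_mul]

omit [LinearOrder K] [IsStrictOrderedRing K] in
/-- Expectation of an affine test function under a probability vector. -/
theorem law_affine {F : Finset K} {w : K → K} (h1 : ∑ y ∈ F, w y = 1) (A d k : K) :
    ∑ y ∈ F, w y * (A + (y - d) * k) = A + ((∑ y ∈ F, w y * y) - d) * k := by
  have e : ∀ y, w y * (A + (y - d) * k) = (A - d * k) * w y + k * (w y * y) := fun y => by ring
  simp_rw [e, Finset.sum_add_distrib, ← Finset.mul_sum, h1]; ring

/-- **Every `F`-valued law lies above the chord of its mean's cell.**  If the cell `[d, u]` of `c`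
is non-degenerate and `f` is convex, then for any probability vector `w` on `F` with mean `m`:
`f(d) + (m − d)(f(u) − f(d))/(u − d) ≤ ∑ w(y) f(y)` — because every point of `F` lies outside
the open cell, where `f` dominates the chord. -/
theorem chord_le_law {F : Finset K} {c : K} (hdu : dn F c < up F c) {w : K → K}
    (hw : ∀ y ∈ F, 0 ≤ w y) (h1 : ∑ y ∈ F, w y = 1) {f : K → K}
    (hf : ConvexOn K Set.univ f) :
    f (dn F c) + ((∑ y ∈ F, w y * y) - dn F c) * ((f (up F c) - f (dn F c)) / (up F c - dn F c))
      ≤ ∑ y ∈ F, w y * f y := by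
  rw [← law_affine h1]
  exact Finset.sum_le_sum fun y hy => mul_le_mul_of_nonneg_left
    (chord_le_of_convexOn hf hdu (mem_le_dn_or_up_le hy)) (hw y hy)

/-- **STOCHASTIC ROUNDING IS THE CONVEX-ORDER-MINIMAL RANDOMISED ROUNDING.**  For every
probability vector `w` on a nonempty value set `F` and every convex `f : K → K`,
`E f(SR_F(m)) ≤ ∑_{y ∈ F} w(y) f(y)` where `m = ∑ w(y)·y` is the mean of `w`.  Equivalently:
among all `F`-valued randomised roundings with a prescribed mean, CHM stochastic rounding
minimises every convex functional (variance, all absolute central moments, `E exp(λ·error)`, …).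
Saturation is built in: the mean of an `F`-valued law is automatically in the hull. [new] -/
theorem step_le_law {F : Finset K} (hF : F.Nonempty) {w : K → K} (hw : ∀ y ∈ F, 0 ≤ w y)
    (h1 : ∑ y ∈ F, w y = 1) {f : K → K} (hf : ConvexOn K Set.univ f) :
    step F (∑ y ∈ F, w y * y) f ≤ ∑ y ∈ F, w y * f y := by
  have hc : InHull F (∑ y ∈ F, w y * y) := law_inHull hF hw h1
  have h1' : dn F (∑ y ∈ F, w y * y) ≤ ∑ y ∈ F, w y * y := by
    simpa [clamp_eq_self hc] using dn_le_clamp F (∑ y ∈ F, w y * y)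
  have h2' : ∑ y ∈ F, w y * y ≤ up F (∑ y ∈ F, w y * y) := by
    simpa [clamp_eq_self hc] using clamp_le_up F (∑ y ∈ F, w y * y)
  rcases eq_or_lt_of_le (h1'.trans h2') with heq | hlt
  · -- degenerate cell: the mean is a point of `F`, SR is exact, and this is Jensen
    have hdm : dn F (∑ y ∈ F, w y * y) = ∑ y ∈ F, w y * y := le_antisymm h1' (heq ▸ h2')
    have hum : up F (∑ y ∈ F, w y * y) = ∑ y ∈ F, w y * y := le_antisymm (heq ▸ h1') h2'
    have hs : step F (∑ y ∈ F, w y * y) f = f (∑ y ∈ F, w y * y) := by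
      unfold step; rw [hdm, hum]; ring
    rw [hs]
    have hj := hf.map_sum_le (t := F) (w := w) (p := fun y => y) hw h1
      (fun y _ => Set.mem_univ y)
    simpa [smul_eq_mul] using hj
  · rw [step_eq_affine hc h1' h2' f]
    exact chord_le_law hlt hw h1 hf

/-- **SR has the least variance among all unbiased `F`-valued roundings of `a`**: if
`∑ w(y)·y = a` then `v_F(a) ≤ ∑ w(y)(y − a)²`. [new] -/
theorem srVar_le_law_of_mean_eq {F : Finset K} (hF : F.Nonempty) {w : K → K}
    (hw : ∀ y ∈ F, 0 ≤ w y) (h1 : ∑ y ∈ F, w y = 1) {a : K} (hm : ∑ y ∈ F, w y * y = a) :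
    srVar F a ≤ ∑ y ∈ F, w y * (y - a) ^ 2 := by
  have h := step_le_law hF hw h1 (convexOn_sq_sub a)
  have hc : InHull F a := hm ▸ law_inHull hF hw h1
  have e : (fun z : K => (z - a) ^ 2) = fun t => (t + -a) ^ 2 := by funext z; ring
  rw [hm, e, step_sq_add, clamp_eq_self hc] at h
  simpa [e] using h

/-! ### The exact bias–MSE frontier -/

omit [IsStrictOrderedRing K] in
/-- Inside the hull the SR variance is `(a − d)(u − a)` in terms of the two candidates. -/
theorem srVar_eq_dn_up {F : Finset K} {a : K} (ha : InHull F a) :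
    srVar F a = (a - dn F a) * (up F a - a) := by
  unfold dn up; rw [clamp_eq_self ha]; exact srVar_eq F a

/-- Every point of `F` lies outside the open cell of `c`: `(y − ⌊c⌋)(y − ⌈c⌉) ≥ 0`. -/
theorem mul_sub_dn_sub_up_nonneg {F : Finset K} (c : K) {y : K} (hy : y ∈ F) :
    0 ≤ (y - dn F c) * (y - up F c) := by
  have hdu : dn F c ≤ up F c := roundDown_le_roundUp F (clamp F c)
  rcases mem_le_dn_or_up_le (c := c) hy with h | h
  · exact mul_nonneg_of_nonpos_of_nonpos (sub_nonpos.mpr h) (sub_nonpos.mpr (h.trans hdu))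
  · exact mul_nonneg (sub_nonneg.mpr (hdu.trans h)) (sub_nonneg.mpr h)

/-- The off-cell penalty `∑ w(y)(y − ⌊c⌋)(y − ⌈c⌉)` of a probability vector is non-negative. -/
theorem law_penalty_nonneg {F : Finset K} (c : K) {w : K → K} (hw : ∀ y ∈ F, 0 ≤ w y) :
    0 ≤ ∑ y ∈ F, w y * ((y - dn F c) * (y - up F c)) :=
  Finset.sum_nonneg fun y hy => mul_nonneg (hw y hy) (mul_sub_dn_sub_up_nonneg c hy)

omit [LinearOrder K] [IsStrictOrderedRing K] in
/-- **THE EXACT MSE DECOMPOSITION.**  For any probability vector `w` on `F` with mean `m` and any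
reference points `a, d, u`:
`∑ w(y)(y − a)² = (a − d)(u − a) + (m − a)(d + u − 2a) + ∑ w(y)(y − d)(y − u)`.
With `d = ⌊a⌋, u = ⌈a⌉` the three terms are: the SR variance, the (signed) bias term, and the
off-cell penalty. [new] -/
theorem law_sq_eq_frontier_add {F : Finset K} {w : K → K} (h1 : ∑ y ∈ F, w y = 1)
    (a d u : K) :
    ∑ y ∈ F, w y * (y - a) ^ 2 =
      (a - d) * (u - a) + ((∑ y ∈ F, w y * y) - a) * (d + u - 2 * a)
        + ∑ y ∈ F, w y * ((y - d) * (y - u)) := by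
  have e : ∀ y, w y * (y - a) ^ 2 =
      ((a - d) * (u - a) - a * (d + u - 2 * a)) * w y + (d + u - 2 * a) * (w y * y)
        + w y * ((y - d) * (y - u)) := fun y => by ring
  simp_rw [e, Finset.sum_add_distrib, ← Finset.mul_sum, h1]; ring

/-- **THE BIAS–MSE FRONTIER (inequality form).**  For `a` in the hull with neighbours `d, u` and
ANY randomised rounding `w` into `F` with mean `m`:
`v_F(a) + (m − a)(d + u − 2a) ≤ ∑ w(y)(y − a)²`.  The achievable (bias, MSE) region lies above a
straight line through SR's point `(0, v_F(a))` with slope `d + u − 2a = −2·(a − midpoint)`. [new] -/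
theorem law_sq_ge_frontier {F : Finset K} {a : K} (ha : InHull F a) {w : K → K}
    (hw : ∀ y ∈ F, 0 ≤ w y) (h1 : ∑ y ∈ F, w y = 1) :
    srVar F a + ((∑ y ∈ F, w y * y) - a) * (dn F a + up F a - 2 * a)
      ≤ ∑ y ∈ F, w y * (y - a) ^ 2 := by
  rw [law_sq_eq_frontier_add h1 a (dn F a) (up F a), srVar_eq_dn_up ha]
  linarith [law_penalty_nonneg a hw]

/-- **Frontier equality ⇔ support on the two neighbours.**  A randomised rounding sits ON the
bias–MSE frontier iff it puts no mass outside `{⌊a⌋, ⌈a⌉}`. [new] -/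
theorem law_sq_eq_frontier_iff {F : Finset K} {a : K} (ha : InHull F a) {w : K → K}
    (hw : ∀ y ∈ F, 0 ≤ w y) (h1 : ∑ y ∈ F, w y = 1) :
    ∑ y ∈ F, w y * (y - a) ^ 2
        = srVar F a + ((∑ y ∈ F, w y * y) - a) * (dn F a + up F a - 2 * a)
      ↔ ∀ y ∈ F, w y = 0 ∨ y = dn F a ∨ y = up F a := by
  rw [law_sq_eq_frontier_add h1 a (dn F a) (up F a), srVar_eq_dn_up ha]
  have hnn : ∀ y ∈ F, 0 ≤ w y * ((y - dn F a) * (y - up F a)) :=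
    fun y hy => mul_nonneg (hw y hy) (mul_sub_dn_sub_up_nonneg a hy)
  constructor
  · intro h y hy
    have h0 : ∑ y ∈ F, w y * ((y - dn F a) * (y - up F a)) = 0 := by linarith
    have hy0 := (Finset.sum_eq_zero_iff_of_nonneg hnn).mp h0 y hy
    rcases mul_eq_zero.mp hy0 with h' | h'
    · exact Or.inl h'
    · rcases mul_eq_zero.mp h' with h'' | h''
      · exact Or.inr (Or.inl (sub_eq_zero.mp h''))
      · exact Or.inr (Or.inr (sub_eq_zero.mp h''))
  · intro h
    have h0 : ∑ y ∈ F, w y * ((y - dn F a) * (y - up F a)) = 0 := by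
      refine Finset.sum_eq_zero fun y hy => ?_
      rcases h y hy with h' | h' | h' <;> simp [h']
    linarith

omit [IsStrictOrderedRing K] in
/-- A probability vector supported on two points `d ≠ u` of `F` integrates `g` as
`w(d) g(d) + w(u) g(u)`. -/
theorem law_sum_of_support {F : Finset K} {d u : K} (hd : d ∈ F) (hu : u ∈ F) (hne : d ≠ u)
    {w : K → K} (h : ∀ y ∈ F, w y = 0 ∨ y = d ∨ y = u) (g : K → K) :
    ∑ y ∈ F, w y * g y = w d * g d + w u * g u := by
  rw [← Finset.add_sum_erase F _ hd,
    ← Finset.add_sum_erase (F.erase d) _ (Finset.mem_erase.mpr ⟨hne.symm, hu⟩),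
    Finset.sum_eq_zero, add_zero]
  intro y hy
  obtain ⟨hyu, hy'⟩ := Finset.mem_erase.mp hy
  obtain ⟨hyd, hyF⟩ := Finset.mem_erase.mp hy'
  rcases h y hyF with h0 | h0 | h0
  · simp [h0]
  · exact absurd h0 hyd
  · exact absurd h0 hyu

/-- **UNIQUENESS.**  In a non-degenerate cell, an unbiased randomised rounding of `a` whose
variance equals the SR variance IS stochastic rounding: it puts mass `pUp F a` on `⌈a⌉`,
`1 − pUp F a` on `⌊a⌋`, and nothing elsewhere. [new] -/
theorem law_eq_sr_of_var_eq {F : Finset K} {a : K} (ha : InHull F a) (hdu : dn F a < up F a)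
    {w : K → K} (hw : ∀ y ∈ F, 0 ≤ w y) (h1 : ∑ y ∈ F, w y = 1)
    (hm : ∑ y ∈ F, w y * y = a) (hv : ∑ y ∈ F, w y * (y - a) ^ 2 = srVar F a) :
    w (up F a) = pUp F a ∧ w (dn F a) = 1 - pUp F a ∧
      ∀ y ∈ F, y ≠ dn F a → y ≠ up F a → w y = 0 := by
  have hF : F.Nonempty := by obtain ⟨⟨z, hz, -⟩, -⟩ := ha; exact ⟨z, hz⟩
  have hsupp : ∀ y ∈ F, w y = 0 ∨ y = dn F a ∨ y = up F a := by
    refine (law_sq_eq_frontier_iff ha hw h1).mp ?_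
    rw [hv, hm]; ring
  have hs1 := law_sum_of_support (dn_mem hF a) (up_mem hF a) hdu.ne hsupp (fun _ => (1 : K))
  have hsy := law_sum_of_support (dn_mem hF a) (up_mem hF a) hdu.ne hsupp (fun y => y)
  simp only [mul_one] at hs1
  rw [h1] at hs1
  rw [hm] at hsy
  have hp : pUp F a = (a - dn F a) / (up F a - dn F a) := by
    unfold pUp probUp dn up; rw [clamp_eq_self ha]
  have hne : up F a - dn F a ≠ 0 := sub_ne_zero.mpr hdu.ne'
  have hu : w (up F a) = pUp F a := by
    rw [hp, eq_div_iff hne]; linear_combination (-1 : K) * hsy + dn F a * hs1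
  refine ⟨hu, by rw [← hu]; linarith [hs1], fun y hy h1y h2y => ?_⟩
  rcases hsupp y hy with h | h | h
  · exact h
  · exact absurd h h1y
  · exact absurd h h2y

/-- **The round-to-nearest end of the frontier.**  No randomised rounding into `F` — biased or
not — has mean-square error about `a` below `min((a − ⌊a⌋)², (⌈a⌉ − a)²)`, the error of
round-to-nearest (attained by the point mass at the nearer neighbour). [new] -/
theorem law_sq_ge_nearest {F : Finset K} {a : K} (ha : InHull F a) {w : K → K}
    (hw : ∀ y ∈ F, 0 ≤ w y) (h1 : ∑ y ∈ F, w y = 1) :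
    min ((a - dn F a) ^ 2) ((up F a - a) ^ 2) ≤ ∑ y ∈ F, w y * (y - a) ^ 2 := by
  have hda : dn F a ≤ a := by simpa [clamp_eq_self ha] using dn_le_clamp F a
  have hau : a ≤ up F a := by simpa [clamp_eq_self ha] using clamp_le_up F a
  calc min ((a - dn F a) ^ 2) ((up F a - a) ^ 2)
      = ∑ y ∈ F, w y * min ((a - dn F a) ^ 2) ((up F a - a) ^ 2) := by
        rw [← Finset.sum_mul, h1, one_mul]
    _ ≤ ∑ y ∈ F, w y * (y - a) ^ 2 := by
        refine Finset.sum_le_sum fun y hy => mul_le_mul_of_nonneg_left ?_ (hw y hy)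
        rcases mem_le_dn_or_up_le (c := a) hy with h | h
        · exact min_le_of_left_le (by nlinarith [h, hda])
        · exact min_le_of_right_le (by nlinarith [h, hau])

omit [LinearOrder K] [IsStrictOrderedRing K] in
/-- **Two-point laws are exactly the frontier.**  The law `u` w.p. `p`, `d` w.p. `1 − p` has
MSE `(a − d)(u − a) + bias·(d + u − 2a)` with `bias = p u + (1 − p) d − a` (pure algebra; no
constraint on `p`). -/
theorem twoPoint_sq_eq_frontier (p a d u : K) :
    p * (u - a) ^ 2 + (1 - p) * (d - a) ^ 2 =
      (a - d) * (u - a) + (p * u + (1 - p) * d - a) * (d + u - 2 * a) := by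
  ring

/-! ### Limited random bits: every `SR_q` sits on the frontier -/

omit [IsStrictOrderedRing K] in
/-- **LIMITED-PRECISION SR LIES ON THE FRONTIER.**  For ANY probability assignment `q` on the two
candidates (file XIX's `stepQ`: `StochasticA/B/C`, few-bit comparators, …) and `c` in the hull:
`E (SR_q(c) − c)² = v_F(c) + (E SR_q(c) − c)·(⌊c⌋ + ⌈c⌉ − 2c)` exactly — the MSE of a
limited-bits rounding is determined by its bias alone. [new] -/
theorem stepQ_sq_eq_frontier (F : Finset K) (q : K → K) {c : K} (hc : InHull F c) :
    LimitedBits.stepQ F q c (fun z => (z - c) ^ 2)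
      = srVar F c + (LimitedBits.stepQ F q c (fun z => z) - c) * (dn F c + up F c - 2 * c) := by
  unfold LimitedBits.stepQ
  rw [srVar_eq_dn_up hc]
  ring

/-- Hence a limited-bits rounding has MSE at most the SR variance iff its bias has the sign of
`2c − ⌊c⌋ − ⌈c⌉`, i.e. points towards the NEARER neighbour:
`E (SR_q(c) − c)² ≤ v_F(c) ↔ bias·(⌊c⌋ + ⌈c⌉ − 2c) ≤ 0`. [new] -/
theorem stepQ_sq_le_srVar_iff (F : Finset K) (q : K → K) {c : K} (hc : InHull F c) :
    LimitedBits.stepQ F q c (fun z => (z - c) ^ 2) ≤ srVar F c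
      ↔ (LimitedBits.stepQ F q c (fun z => z) - c) * (dn F c + up F c - 2 * c) ≤ 0 := by
  rw [stepQ_sq_eq_frontier F q hc]
  constructor <;> intro h <;> linarith

end Generic

/-! ### Minifloat formats and a kernel-checked FP4 witness -/

section Formats

open Literature.ComputerArithmetic.FloatingPoint

/-- **Format-level statement.**  For every minifloat format `φ`, every `|a| ≤ maxRat φ`, every
unbiased randomised rounding `w` of `a` into the value set of `φ` and every convex `f`:
`E f(SR_φ(a)) ≤ ∑ w(y) f(y)`.  The hypothesis `|a| ≤ maxRat` is exactly the representable-hull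
condition; beyond it no unbiased `φ`-valued rounding exists at all. [new] -/
theorem valueSet_step_le_law (φ : Format) {a : ℚ} (ha : |a| ≤ φ.maxRat) {w : ℚ → ℚ}
    (hw : ∀ y ∈ MiniFloat.valueSet φ, 0 ≤ w y) (h1 : ∑ y ∈ MiniFloat.valueSet φ, w y = 1)
    (hm : ∑ y ∈ MiniFloat.valueSet φ, w y * y = a) {f : ℚ → ℚ}
    (hf : ConvexOn ℚ Set.univ f) :
    step (MiniFloat.valueSet φ) a f ≤ ∑ y ∈ MiniFloat.valueSet φ, w y * f y := by
  have hF : (MiniFloat.valueSet φ).Nonempty := by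
    obtain ⟨⟨z, hz, -⟩, -⟩ := (valueSet_inHull_iff φ a).mpr ha; exact ⟨z, hz⟩
  simpa [hm] using step_le_law hF hw h1 hf

/-- **No unbiased rounding beyond the hull**: if `maxRat φ < |a|` there is no probability vector
on the value set of `φ` with mean `a` (the textbook "E SR(x) = x" must fail under saturation,
whatever the randomisation). [new] -/
theorem no_unbiased_law_of_maxRat_lt (φ : Format) {a : ℚ} (ha : φ.maxRat < |a|) {w : ℚ → ℚ}
    (hw : ∀ y ∈ MiniFloat.valueSet φ, 0 ≤ w y) (h1 : ∑ y ∈ MiniFloat.valueSet φ, w y = 1) :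
    ∑ y ∈ MiniFloat.valueSet φ, w y * y ≠ a := by
  intro hm
  have hF : (MiniFloat.valueSet φ).Nonempty := by
    rcases Finset.eq_empty_or_nonempty (MiniFloat.valueSet φ) with h | h
    · rw [h, Finset.sum_empty] at h1; exact absurd h1 zero_ne_one
    · exact h
  have := (valueSet_inHull_iff φ a).mp (hm ▸ law_inHull hF hw h1)
  exact absurd ha (not_lt.mpr this)

/-- **FP4 witness (kernel-checked on the literal E2M1 table).**  At `a = 5/4` (neighbours `1`
and `3/2`) SR has variance `1/16`; the unbiased "dither" law `{1/2 ↦ 1/2, 2 ↦ 1/2}` has MSE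
`9/16 = 1/16 + 0·(bias term) + 1/2` — the off-cell penalty `∑ w(y)(y − 1)(y − 3/2) = 1/2`
accounts exactly for the excess, as `law_sq_eq_frontier_add` predicts. -/
theorem fp4_dither_witness :
    step FP4.e2m1 (5 / 4 : ℚ) (fun z => (z - 5 / 4) ^ 2) = 1 / 16 ∧
    (1 / 2 : ℚ) * (1 / 2 - 5 / 4) ^ 2 + 1 / 2 * (2 - 5 / 4) ^ 2 = 9 / 16 ∧
    (1 / 2 : ℚ) * ((1 / 2 - 1) * (1 / 2 - 3 / 2)) + 1 / 2 * ((2 - 1) * (2 - 3 / 2)) = 1 / 2 := by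
  refine ⟨by decide +kernel, by norm_num, by norm_num⟩

end Formats

end Summit.Ventures.CertifiedArithmetic.LowPrec.SR
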